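import Literature.Topology.FourManifolds.KirbyMovesSlideEndChart
import HarnessLib

/-!
# Normalising the band end: vocabulary (normal and base coordinates, base lift, thickening)

Topic `Literature/Topology/FourManifolds`; fact seat `provefact-IsStrictHandleSlide.isSurgery`
(R. C. Kirby, *The Topology of 4-Manifolds*, LNM 1374 (1989), Ch. I §4; remaining content: the
named fact (S) `Literature.Topology.FourManifolds.FramedLink.IsStrictHandleSlide.slideModel`).
The files `KirbyMovesSlideEndData*.lean`, `KirbyMovesSlideEndStepA*.lean`,
`KirbyMovesSlideEndChart.lean` work with the band end read in the tube `ν` of `Kⱼ` through long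
explicit expressions; for the flattening step (a straight-line isotopy extension in a chart, as
in the uniqueness of tubular neighbourhoods, `LinkTubularUniqueness.lean`) we name them.
Definitions (honest abbreviations of those expressions, each with its unfolding lemma) and the
earlier results restated in this vocabulary; no named facts:

* `BandCore.tubeNormal ν b x = (ν⁻¹ (band x)).2`, `BandCore.tubeBase ν b x = (ν⁻¹ (band x)).1`;
* `BandCore.baseLift ν b x` — the moving-centre angle lift of `tubeBase` (`KirbyMovesSlideEndChart.lean`),
  `BandCore.baseLiftDom ν b` its open domain;
* `BandCore.thickening ν b (x, z) = ν (circlePt (baseLift x), tubeNormal x + z • e_y)` — the band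
  end thickened in the direction `e_y = (0, 1)` of the fibre plane, a local parametrisation of
  `S³` near the attaching arc whose restriction to `z = 0` is the band (`thickening_zero`).

## References

* R. C. Kirby, *The Topology of 4-Manifolds*, LNM 1374, Springer (1989), Ch. I §4. [Kirby1989]
* A. Kosinski, *Differential Manifolds* (1993), Ch. III, Thm. (3.5). [Kosinski1993]
-/

open scoped Manifold ContDiff Topology
open Function Set Metric

noncomputable section

namespace Literature.Topology.FourManifolds

namespace BandCore

variable [Knot.TubularNbhd.SmoothnessFacts] {A Kj : Knot} (ν : Knot.TubularNbhd Kj)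
  {avoid : Set (Metric.sphere (0 : EuclideanSpace ℝ (Fin 4)) 1)} (b : BandCore A ν.pushOff avoid)

/-- **The normal coordinate of the band end** in the tube `ν` of `Kⱼ`: `W x = (ν⁻¹ (band x)).2`
(meaningful where `band x ∈ ν (S¹ × ℝ²)`). [cite: Kirby1989, Ch. I §4] -/
def tubeNormal (x : EuclideanSpace ℝ (Fin 2)) : EuclideanSpace ℝ (Fin 2) :=
  (ν.toTubeNbhd.toHomeo.symm (b.band x)).2

/-- **The base coordinate of the band end** in the tube `ν` of `Kⱼ`: `U x = (ν⁻¹ (band x)).1 ∈ S¹`.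
[cite: Kirby1989, Ch. I §4] -/
def tubeBase (x : EuclideanSpace ℝ (Fin 2)) : Metric.sphere (0 : EuclideanSpace ℝ (Fin 2)) 1 :=
  (ν.toTubeNbhd.toHomeo.symm (b.band x)).1

/-- **The base lift**: the angle `thetaB x₁ + (2π)⁻¹ arcsin (circlePt (thetaB x₁) × U x)`, a lift
of `U x` through `circlePt` near the right edge (`KirbyMovesSlideEndChart.lean`). [folklore] -/
def baseLift (x : EuclideanSpace ℝ (Fin 2)) : ℝ :=
  b.thetaB (x 1) + (2 * Real.pi)⁻¹ *
    Real.arcsin (Real.cos (2 * Real.pi * b.thetaB (x 1)) * (b.tubeBase ν x : EuclideanSpace ℝ (Fin 2)) 1 -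
      Real.sin (2 * Real.pi * b.thetaB (x 1)) * (b.tubeBase ν x : EuclideanSpace ℝ (Fin 2)) 0)

/-- **The domain of the base lift**: parameters mapped into the tube, of height in `(1/10, 9/10)`,
with base coordinate in the open half-circle about `circlePt (thetaB x₁)`. [folklore] -/
def baseLiftDom : Set (EuclideanSpace ℝ (Fin 2)) :=
  {x | x ∈ b.band ⁻¹' range ⇑ν ∧ x 1 ∈ Ioo (10⁻¹ : ℝ) (9 / 10) ∧
    0 < Real.cos (2 * Real.pi * b.thetaB (x 1)) * (b.tubeBase ν x : EuclideanSpace ℝ (Fin 2)) 0 +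
      Real.sin (2 * Real.pi * b.thetaB (x 1)) * (b.tubeBase ν x : EuclideanSpace ℝ (Fin 2)) 1}

/-- **The thickening of the band end**: `(x, z) ↦ ν (circlePt (baseLift x), W x + z • e_y)`,
`e_y = (0, 1)`. [folklore] -/
def thickening (p : EuclideanSpace ℝ (Fin 2) × ℝ) : Metric.sphere (0 : EuclideanSpace ℝ (Fin 4)) 1 :=
  ν (circlePt (b.baseLift ν p.1), b.tubeNormal ν p.1 + p.2 • EuclideanSpace.single (1 : Fin 2) (1 : ℝ))

/-! ### Unfolding lemmas -/

/-- Unfolding `tubeNormal`. [folklore] -/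
theorem tubeNormal_def (x : EuclideanSpace ℝ (Fin 2)) :
    b.tubeNormal ν x = (ν.toTubeNbhd.toHomeo.symm (b.band x)).2 := rfl

/-- Unfolding `tubeBase`. [folklore] -/
theorem tubeBase_def (x : EuclideanSpace ℝ (Fin 2)) :
    b.tubeBase ν x = (ν.toTubeNbhd.toHomeo.symm (b.band x)).1 := rfl

/-- Unfolding `baseLift`. [folklore] -/
theorem baseLift_def (x : EuclideanSpace ℝ (Fin 2)) :
    b.baseLift ν x = b.thetaB (x 1) + (2 * Real.pi)⁻¹ *
      Real.arcsin (Real.cos (2 * Real.pi * b.thetaB (x 1)) * (b.tubeBase ν x : EuclideanSpace ℝ (Fin 2)) 1 -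
        Real.sin (2 * Real.pi * b.thetaB (x 1)) * (b.tubeBase ν x : EuclideanSpace ℝ (Fin 2)) 0) := rfl

/-- Membership in `baseLiftDom`. [folklore] -/
theorem mem_baseLiftDom_iff (x : EuclideanSpace ℝ (Fin 2)) :
    x ∈ b.baseLiftDom ν ↔ x ∈ b.band ⁻¹' range ⇑ν ∧ x 1 ∈ Ioo (10⁻¹ : ℝ) (9 / 10) ∧
      0 < Real.cos (2 * Real.pi * b.thetaB (x 1)) * (b.tubeBase ν x : EuclideanSpace ℝ (Fin 2)) 0 +
        Real.sin (2 * Real.pi * b.thetaB (x 1)) * (b.tubeBase ν x : EuclideanSpace ℝ (Fin 2)) 1 := Iff.rfl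

/-- Unfolding `thickening`. [folklore] -/
theorem thickening_apply (x : EuclideanSpace ℝ (Fin 2)) (z : ℝ) :
    b.thickening ν (x, z) =
      ν (circlePt (b.baseLift ν x), b.tubeNormal ν x + z • EuclideanSpace.single (1 : Fin 2) (1 : ℝ)) := rfl

/-- The tube coordinates of the band end are the pair (base, normal). [folklore] -/
theorem tubeCoord_eq (x : EuclideanSpace ℝ (Fin 2)) :
    ν.toTubeNbhd.toHomeo.symm (b.band x) = (b.tubeBase ν x, b.tubeNormal ν x) := Prod.ext rfl rfl

/-! ### The earlier results in this vocabulary -/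

/-- The domain of the base lift is open. [folklore] -/
theorem isOpen_baseLiftDom' : IsOpen (b.baseLiftDom ν) := b.isOpen_baseLiftDom ν

/-- The open edge segment lies in the domain. [folklore] -/
theorem pt2_one_mem_baseLiftDom' {y : ℝ} (hy : y ∈ Ioo (10⁻¹ : ℝ) (9 / 10)) : pt2 1 y ∈ b.baseLiftDom ν :=
  b.pt2_one_mem_baseLiftDom ν hy

/-- The domain lies in the set of parameters mapped into the tube. [folklore] -/
theorem baseLiftDom_subset : b.baseLiftDom ν ⊆ b.band ⁻¹' range ⇑ν := fun _ hx ↦ hx.1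

/-- On the domain, `circlePt (baseLift x) = tubeBase x`. [folklore] -/
theorem circlePt_baseLift' {x : EuclideanSpace ℝ (Fin 2)} (hx : x ∈ b.baseLiftDom ν) :
    circlePt (b.baseLift ν x) = b.tubeBase ν x := b.circlePt_baseLift ν hx.2.2

/-- On the domain, the band is `ν (circlePt (baseLift x), tubeNormal x)`. [folklore] -/
theorem band_eq_tube {x : EuclideanSpace ℝ (Fin 2)} (hx : x ∈ b.baseLiftDom ν) :
    b.band x = ν (circlePt (b.baseLift ν x), b.tubeNormal ν x) := b.band_eq_tube_baseLift ν hx.1 hx.2.2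

/-- **The thickening restricts to the band**: `thickening (x, 0) = band x` on the domain. [folklore] -/
theorem thickening_zero {x : EuclideanSpace ℝ (Fin 2)} (hx : x ∈ b.baseLiftDom ν) :
    b.thickening ν (x, 0) = b.band x := by
  rw [thickening_apply, zero_smul, add_zero, ← b.band_eq_tube ν hx]

/-- On the edge, `baseLift (1, y) = thetaB y`. [folklore] -/
theorem baseLift_pt2_one' {y : ℝ} (hy : y ∈ Icc (10⁻¹ : ℝ) (9 / 10)) : b.baseLift ν (pt2 1 y) = b.thetaB y :=
  b.baseLift_pt2_one ν hy

/-- On the edge, `tubeNormal (1, y) = e₀`. [folklore] -/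
theorem tubeNormal_pt2_one {y : ℝ} (hy : y ∈ Icc (10⁻¹ : ℝ) (9 / 10)) : b.tubeNormal ν (pt2 1 y) = framingBaseVector :=
  b.tubeNormal_band_pt2_one ν hy

/-- On the edge, `tubeBase (1, y) = circlePt (thetaB y)`. [folklore] -/
theorem tubeBase_pt2_one {y : ℝ} (hy : y ∈ Icc (10⁻¹ : ℝ) (9 / 10)) : b.tubeBase ν (pt2 1 y) = circlePt (b.thetaB y) :=
  b.tubeBase_band_pt2_one ν hy

/-- **The thickening on the edge is the push-off**: `thickening ((1, y), 0) = Kⱼ' (circlePt (thetaB y))`.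
[folklore] -/
theorem thickening_pt2_one_zero {y : ℝ} (hy : y ∈ Icc (10⁻¹ : ℝ) (9 / 10)) :
    b.thickening ν (pt2 1 y, 0) = ν.pushOff (circlePt (b.thetaB y)) := by
  rw [thickening_apply, zero_smul, add_zero, b.baseLift_pt2_one' ν hy, b.tubeNormal_pt2_one ν hy,
    Knot.TubularNbhd.pushOff_apply]

/-- `tubeNormal` is `C^∞` on the parameters mapped into the tube. [folklore] -/
theorem contDiffOn_tubeNormal'' : ContDiffOn ℝ ∞ (b.tubeNormal ν) (b.band ⁻¹' range ⇑ν) :=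
  b.contDiffOn_tubeNormal' ν

/-- `tubeBase`, read in `ℝ²`, is `C^∞` on the parameters mapped into the tube. [folklore] -/
theorem contDiffOn_tubeBase_coe :
    ContDiffOn ℝ ∞ (fun x ↦ (b.tubeBase ν x : EuclideanSpace ℝ (Fin 2))) (b.band ⁻¹' range ⇑ν) :=
  b.contDiffOn_tubeBaseCoe ν

/-- `baseLift` is `C^∞` on its domain. [folklore] -/
theorem contDiffOn_baseLift' : ContDiffOn ℝ ∞ (b.baseLift ν) (b.baseLiftDom ν) := b.contDiffOn_baseLift ν

/-- **The thickening is smooth** on `baseLiftDom × ℝ`. [folklore] -/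
theorem contMDiffOn_thickening :
    ContMDiffOn (𝓘(ℝ, EuclideanSpace ℝ (Fin 2) × ℝ)) (𝓡 3) ∞ (b.thickening ν) ((b.baseLiftDom ν) ×ˢ univ) := by
  have h1 : ContMDiffOn (𝓘(ℝ, EuclideanSpace ℝ (Fin 2) × ℝ)) 𝓘(ℝ, ℝ) ∞ (fun p : EuclideanSpace ℝ (Fin 2) × ℝ ↦ b.baseLift ν p.1)
      ((b.baseLiftDom ν) ×ˢ univ) :=
    ((b.contDiffOn_baseLift' ν).comp contDiff_fst.contDiffOn fun p hp ↦ hp.1).contMDiffOn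
  have h2 : ContMDiffOn (𝓘(ℝ, EuclideanSpace ℝ (Fin 2) × ℝ)) 𝓘(ℝ, EuclideanSpace ℝ (Fin 2)) ∞
      (fun p : EuclideanSpace ℝ (Fin 2) × ℝ ↦ b.tubeNormal ν p.1 + p.2 • EuclideanSpace.single (1 : Fin 2) (1 : ℝ))
      ((b.baseLiftDom ν) ×ˢ univ) := by
    have ha : ContDiffOn ℝ ∞ (fun p : EuclideanSpace ℝ (Fin 2) × ℝ ↦ b.tubeNormal ν p.1) ((b.baseLiftDom ν) ×ˢ univ) :=
      (b.contDiffOn_tubeNormal'' ν).comp contDiff_fst.contDiffOn fun p hp ↦ hp.1.1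
    have hb : ContDiff ℝ ∞ (fun p : EuclideanSpace ℝ (Fin 2) × ℝ ↦ p.2 • EuclideanSpace.single (1 : Fin 2) (1 : ℝ)) :=
      contDiff_snd.smul contDiff_const
    exact (ha.add hb.contDiffOn).contMDiffOn
  have h3 : ContMDiffOn (𝓘(ℝ, EuclideanSpace ℝ (Fin 2) × ℝ)) ((𝓡 1).prod 𝓘(ℝ, EuclideanSpace ℝ (Fin 2))) ∞
      (fun p : EuclideanSpace ℝ (Fin 2) × ℝ ↦ ((circlePt (b.baseLift ν p.1),
        b.tubeNormal ν p.1 + p.2 • EuclideanSpace.single (1 : Fin 2) (1 : ℝ)) :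
          Metric.sphere (0 : EuclideanSpace ℝ (Fin 2)) 1 × EuclideanSpace ℝ (Fin 2))) ((b.baseLiftDom ν) ×ˢ univ) :=
    (contMDiff_circlePt.comp_contMDiffOn h1).prodMk h2
  exact ν.contMDiff.comp_contMDiffOn h3

end BandCore

end Literature.Topology.FourManifolds
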